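import Literature.MathematicalPhysics.QuantumFieldTheory.Balaban1983to89.B5Eq129FreeResolventWeightedGradientRowCosh
import Literature.MathematicalPhysics.QuantumFieldTheory.Balaban1983to89.B5Eq129CoshWeightPairedShift

/-!
# `Balaban1983to89.B5Eq129FreeResolventWeightedGradientRowPaired` — T. Bałaban, *Propagators and renormalization transformations for lattice gauge theories. I*,
# Commun. Math. Phys. **95** (1984) 17–40 [Balaban1984PropagatorsI] (1.29) p. 23, p. 36, serving [Balaban1985BackgroundPropagators] Thm 3.1 (3.42) p. 397 (the `|∇G|`
# line with its decay weight): **THE WEIGHTED ∇-ROW OF THE FREE MASSIVE RESOLVENT KERNEL FOR EVERY CENTRE WITHIN THE FACTOR `2∕(1+e^{−a})` OF THE ON-SLICE `cosh`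
# BRACKET — `Σ_x W_c(x)|k(x−e_ν) − k(x)| ≤ (2∕(1+e^{−a}))·W_c(0)·[(1 + cosh a)G(0) + 2 sinh a·Σ_{1≤j<⌊N_ν∕2⌋} sinh(aj)G(j)]`** — the reflection orbit
# `x ↦ R_νx + e_ν` of `Π_μ ℤ∕N_μ` (under which the transverse weight and the bond difference `|k(x−e_ν) − k(x)|` are invariant) pairs the ν-factor of the weight
# at `x_ν` with the one at `1 − x_ν`; `B5Eq129CoshWeightPairedShift.paired_shift_letter_torus` bounds the pair by the on-slice pair, and (W-0)
# `B5Eq129FreeResolventWeightedGradientRow.weighted_sum_abs_sub_le_cosh` finishes — the sharpening of `B5Eq129FreeResolventWeightedGradientRowCosh.sum_weight_mul_abs_sub_le`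
# ((W-1′): `(1 + e^a)G(0) + 2 sinh a·Σ e^{aj}G(j)`) announced by t4-ne9-idea-1 g136 (N37)

statement-level skeleton of published theorems with citation tags; proofs where landed; nothing here is a claim about the Yang–Mills mass gap

CITATION HEADER (lean-in-tree rule).  Audit cell `pub-balaban`, sub-cell `t4`, BINDER row NE9; filed by NE9 crux-team LEAF PROVER 05
(`b2b-balaban-t4-ne9-formalise-leaf-05`, gen 82).  MATHEMATICS: t4-ne9-idea-1 gen 135 N36 (`ROW-CENTRE-PROFILE-g135.md`: the exact centre profile on `ℤ^d`, factor
`2∕(1+e^{−a})` between every-centre and on-slice) and gen 136 N37 (`PAIRED-SHIFT-LETTER-g136.md`: the torus pair letter) — credit theirs; the involution bookkeeping on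
`Tor N` is this file's.  OBJECT: [Balaban1984PropagatorsI] (1.29) p. 23's free stencil in the (FS) encoding (`B5Prop11Plancherel.Tor`, `unitVec`; resolvent equation and
shifted-mass cycle solution as HYPOTHESES) and the p. 36 weight in the OWNER's product-`cosh` form (`B5Eq129CoshSupersolution`); [folklore]; nothing of print asserted.

WHAT IS PROVED (sorry-free; 0 `def`).
* **`sum_weight_mul_abs_sub_le_paired`** — EVERY centre `c`, hypotheses of `B5Eq129FreeResolventWeightedGradientRowCosh.sum_weight_mul_abs_sub_le` verbatim:
  `Σ_x W_c(x)·|k(x − e_ν) − k(x)| ≤ (2∕(1+e^{−a}))·W_c(0)·[(1 + cosh a)·G(0) + 2 sinh a·Σ_{1≤j<⌊N_ν∕2⌋} sinh(a·j)·G(j)]`.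
* **`sum_weight_mul_abs_sub_le_paired_uniform`** — folded in the OWNER's window `2d·t²(cosh a − 1) < m`:
  `… ≤ (2∕(1+e^{−a}))·W_c(0)·[(1 + e^{−a})·G(0) + sinh a∕λ]` (`B5Eq129CycleWeightedMass.cosh_bracket_le_uniform`), i.e. `W_c(0)·[2G(0) + 2 sinh a∕((1+e^{−a})λ)]`
  against (W-1′)'s `W_c(0)·[(1+e^{−a})G(0) + 2 sinh a∕λ]`.
Numbers (t4-ne9-idea-1 g136 toys; d = 4, m = 1, κ = ¼, units `t = η⁻¹`, `a = κη`): η = ½ → 0: (W-1′) folded 1.688 → 1.776, THIS 1.438 → 1.443, exact every-centre (`ℤ^d`) 1.251 → 1.202.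
HONEST SCOPE.  Zero rank weight: the every-centre constant multiplies storey J's `θ = S·ε₁` but never decides `θ < 1` (N36 (d)); FLAT stencil; ONE letter of ONE
un-opened storey (J) of row L13; NOT NE9 (cell pub-balaban: NE9 NOT PRINTED ∕ NOT PROVED; «NE9 ⇐ the named binders»; row WALLED ON A MODEL (O-NE9-1; #5 UNRULED); spine
PROVED 0∕9; rung (B)+1 finite T⁴ — NOT infinite volume, NOT mass gap, NOT BetaPertH, NOT Clay).  HONEST DEPENDENCY (cell line): continuum YM on T⁴ ⇐ BetaPertH ∧ nine spine
estimates (0/9 proved); BetaPertH ⇐ (D1) ∧ (D4) ∧ CAP+tail; G-an2-4 gates asym, D1 and NE2/3/4.  NEW file importing `B5Eq129FreeResolventWeightedGradientRowCosh` and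
`B5Eq129CoshWeightPairedShift` only; nothing modified.  Net new unproved facts: 0.
-/

noncomputable section

open scoped BigOperators

namespace Literature.MathematicalPhysics.QuantumFieldTheory.Balaban1983to89.B5Eq129FreeResolventWeightedGradientRowPaired

open B5Prop11Plancherel (Tor unitVec)
open B4TorusKernel.MultiPeriod (circAbs circAbs_add_mul)
open B5Eq129FreeResolventKernelMonotone (kernel_reflect)
open B5Eq129FreeResolventWeightedMarginal (prod_weight_add_unitVec prod_weight_reflect)
open B5Eq129CoshWeightFactorLetters (weight_eq_factor_mul_transverse transverse_pos circAbs_val_eq_min circAbs_neg_val)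
open B5Eq129FreeResolventWeightedGradientRow (weighted_sum_abs_sub_le_cosh)
open B5Eq129FreeResolventWeightedGradientRowCosh (transverse_cosh_defect)
open B5Eq129FreeResolventCycleComparison (cycle_solution_nonneg)
open B5Eq129FreeResolventCycleProfile (cycle_eq_of_resolvent_eq)
open B5Eq129CycleWeightedMass (cosh_bracket_le_uniform)
open B5Eq129CoshWeightPairedShift (paired_shift_letter_torus)

variable {d : ℕ} (N : Fin d → ℕ) [∀ μ, NeZero (N μ)]

/-- the torus distance of the canonical representative of an integer's residue is the torus distance of the integer. [folklore] -/
private theorem circAbs_val_intCast {n : ℕ} [NeZero n] (w : ℤ) : circAbs n ((((w : ZMod n)).val : ℕ) : ℤ) = circAbs n w := by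
  rw [ZMod.val_intCast, Int.emod_def, show w - (n : ℤ) * (w / n) = w + (n : ℤ) * (-(w / n)) by ring, circAbs_add_mul]

/-- the same through an equation of residues. [folklore] -/
private theorem circAbs_val_eq_of_intCast_eq {n : ℕ} [NeZero n] {z : ZMod n} {w : ℤ} (h : (w : ZMod n) = z) :
    circAbs n ((z.val : ℕ) : ℤ) = circAbs n w := by
  rw [← h]
  exact circAbs_val_intCast w

/-- **THE WEIGHTED ∇-ROW FOR EVERY CENTRE, PAIRED.**  Hypotheses of `B5Eq129FreeResolventWeightedGradientRowCosh.sum_weight_mul_abs_sub_le` verbatim (`(L₀+m)k = δ₀`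
on `Π_μ ℤ∕N_μ`, `m > 0`, `a ≥ 0`, `2(d−1)t²(cosh a − 1) < m`, `N_ν ≥ 2`, any centre `c`, `G` the cycle solution at the shifted mass); conclusion with the ON-SLICE
`cosh` bracket and the factor `2∕(1+e^{−a})`:
`Σ_x W_c(x)·|k(x − e_ν) − k(x)| ≤ (2∕(1+e^{−a}))·W_c(0)·[(1 + cosh a)·G(0) + 2 sinh a·Σ_{1≤j<⌊N_ν∕2⌋} sinh(a·j)·G(j)]`.
Proof: `W_c = ψ(x_ν)·Φ(x)` (`weight_eq_factor_mul_transverse`); the map `τ x = R_ν x + e_ν` (`R_ν` the reflection of the ν-coordinate) is an involution of the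
torus with `(τx)_ν = 1 − x_ν`, `Φ∘τ = Φ` (`prod_weight_reflect`, `prod_weight_add_unitVec`), `|k(τx − e_ν) − k(τx)| = |k(x − e_ν) − k(x)|` (`kernel_reflect`); so
twice the sum is `Σ_x [ψ(x_ν) + ψ(1 − x_ν)]·Φ·|∇k|`, the bracket is `≤ (2∕(1+e^{−a}))·ψ(0)·[cosh(a·d(x_ν)) + cosh(a·d(x_ν − 1))]` (`paired_shift_letter_torus`), the
`d(x_ν − 1)` half equals the `d(x_ν)` half after `τ` again (`circAbs_neg_val`), and (W-0) `weighted_sum_abs_sub_le_cosh` bounds `Σ_x cosh(a·d(x_ν))·Φ·|∇k|`.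
[folklore] [cite: Balaban1984PropagatorsI, (1.29) p.23, p.36; Balaban1985BackgroundPropagators, Thm 3.1 (3.42) p.397] -/
theorem sum_weight_mul_abs_sub_le_paired (t : ℝ) {m a : ℝ} (hm : 0 < m) (ha : 0 ≤ a)
    (hCm : 2 * ((d : ℝ) - 1) * t ^ 2 * (Real.cosh a - 1) < m) {k : Tor N → ℝ}
    (hk : ∀ x, ∑ ν, t ^ 2 * ((k x - k (x - unitVec N ν)) + (k x - k (x + unitVec N ν))) + m * k x = if x = 0 then 1 else 0)
    (ν : Fin d) (hn : 2 ≤ N ν) (c : Tor N) {G : ZMod (N ν) → ℝ}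
    (hG : ∀ s, t ^ 2 * ((G s - G (s - 1)) + (G s - G (s + 1))) + (m - 2 * ((d : ℝ) - 1) * t ^ 2 * (Real.cosh a - 1)) * G s =
      if s = 0 then 1 else 0) :
    ∑ x : Tor N, (∏ μ, Real.cosh (a * (circAbs (N μ) ((c μ - x μ : ZMod (N μ)).val) : ℝ))) * |k (x - unitVec N ν) - k x| ≤
      2 / (1 + Real.exp (-a)) * (∏ μ, Real.cosh (a * (circAbs (N μ) ((c μ - (0 : Tor N) μ : ZMod (N μ)).val) : ℝ))) *
        ((1 + Real.cosh a) * G 0 + 2 * Real.sinh a * ∑ j ∈ Finset.Ico 1 (N ν / 2), Real.sinh (a * j) * G (j : ZMod (N ν))) := by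
  classical
  -- names: the ν-factor `ψ`, the transverse product `Φ`, the bond difference `A`
  set ψ : ZMod (N ν) → ℝ := fun s => Real.cosh (a * (circAbs (N ν) ((c ν - s : ZMod (N ν)).val) : ℝ)) with hψ
  set Φ : Tor N → ℝ := fun x => ∏ μ ∈ Finset.univ.erase ν, Real.cosh (a * (circAbs (N μ) ((c μ - x μ : ZMod (N μ)).val) : ℝ)) with hΦ
  set A : Tor N → ℝ := fun x => |k (x - unitVec N ν) - k x| with hA
  have hfac : ∀ x : Tor N, ∏ μ, Real.cosh (a * (circAbs (N μ) ((c μ - x μ : ZMod (N μ)).val) : ℝ)) = ψ (x ν) * Φ x :=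
    fun x => weight_eq_factor_mul_transverse N a c x ν
  have hΦ0 : ∀ x, 0 ≤ Φ x := fun x => (transverse_pos N a c x ν).le
  have hΦν : ∀ x, Φ (x + unitVec N ν) = Φ x :=
    fun x => prod_weight_add_unitVec N ν (fun μ y => Real.cosh (a * (circAbs (N μ) ((c μ - y : ZMod (N μ)).val) : ℝ))) x
  have hΦR : ∀ x, Φ (Function.update x ν (-x ν)) = Φ x :=
    fun x => prod_weight_reflect N ν (fun μ y => Real.cosh (a * (circAbs (N μ) ((c μ - y : ZMod (N μ)).val) : ℝ))) x
  have hA0 : ∀ x, 0 ≤ A x := fun x => abs_nonneg _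
  -- the involution `τ x = R_ν x + e_ν`
  set τ : Tor N → Tor N := fun x => Function.update x ν (-x ν) + unitVec N ν with hτ
  have hτν : ∀ x, τ x ν = 1 - x ν := fun x => by
    simp only [hτ, Pi.add_apply, Function.update_self, unitVec, Pi.single_eq_same]
    ring
  have hτμ : ∀ x μ, μ ≠ ν → τ x μ = x μ := fun x μ h => by
    simp only [hτ, Pi.add_apply, Function.update_of_ne h, unitVec, Pi.single_eq_of_ne h, add_zero]
  have hτinv : Function.Involutive τ := fun x => by
    funext μ
    by_cases h : μ = ν
    · subst h; rw [hτν, hτν]; ring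
    · rw [hτμ _ _ h, hτμ _ _ h]
  have hτsub : ∀ x, τ x - unitVec N ν = Function.update x ν (-x ν) := fun x => by
    rw [hτ]; exact add_sub_cancel_right _ _
  have hτR : ∀ x, τ x = Function.update (x - unitVec N ν) ν (-(x - unitVec N ν) ν) := fun x => by
    funext μ
    by_cases h : μ = ν
    · subst h
      rw [hτν, Function.update_self, Pi.sub_apply, unitVec, Pi.single_eq_same]
      ring
    · rw [hτμ _ _ h, Function.update_of_ne h, Pi.sub_apply, unitVec, Pi.single_eq_of_ne h, sub_zero]
  have hAτ : ∀ x, A (τ x) = A x := fun x => by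
    simp only [hA]
    rw [hτsub, kernel_reflect N t hm hk ν x, hτR, kernel_reflect N t hm hk ν (x - unitVec N ν), abs_sub_comm]
  have hΦτ : ∀ x, Φ (τ x) = Φ x := fun x => by
    have e : τ x = Function.update x ν (-x ν) + unitVec N ν := rfl
    rw [e, hΦν, hΦR]
  have hsum : ∀ F : Tor N → ℝ, ∑ x, F (τ x) = ∑ x, F x := fun F => Equiv.sum_comp (hτinv.toPerm τ) F
  -- the per-site pair letter, in the `ZMod` currency
  have hn1 : 1 ≤ N ν := by omega
  have hpair : ∀ x : Tor N, ψ (x ν) + ψ (τ x ν) ≤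
      2 / (1 + Real.exp (-a)) * ψ 0 * (Real.cosh (a * (circAbs (N ν) (((x ν).val : ℕ) : ℤ) : ℝ)) +
        Real.cosh (a * (circAbs (N ν) (((x ν - 1 : ZMod (N ν)).val : ℕ) : ℤ) : ℝ))) := fun x => by
    have h := paired_shift_letter_torus hn ha (((c ν).val : ℕ) : ℤ) (((x ν).val : ℕ) : ℤ)
    have e1 : circAbs (N ν) (((c ν - x ν : ZMod (N ν)).val : ℕ) : ℤ) = circAbs (N ν) ((((c ν).val : ℕ) : ℤ) - (((x ν).val : ℕ) : ℤ)) :=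
      circAbs_val_eq_of_intCast_eq (by push_cast; rw [ZMod.natCast_zmod_val, ZMod.natCast_zmod_val])
    have e2 : circAbs (N ν) (((c ν - τ x ν : ZMod (N ν)).val : ℕ) : ℤ) = circAbs (N ν) ((((c ν).val : ℕ) : ℤ) + (((x ν).val : ℕ) : ℤ) - 1) :=
      circAbs_val_eq_of_intCast_eq (by rw [hτν]; push_cast; rw [ZMod.natCast_zmod_val, ZMod.natCast_zmod_val]; ring)
    have e3 : circAbs (N ν) (((c ν - 0 : ZMod (N ν)).val : ℕ) : ℤ) = circAbs (N ν) (((c ν).val : ℕ) : ℤ) := by rw [sub_zero]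
    have e4 : circAbs (N ν) (((x ν - 1 : ZMod (N ν)).val : ℕ) : ℤ) = circAbs (N ν) ((((x ν).val : ℕ) : ℤ) - 1) :=
      circAbs_val_eq_of_intCast_eq (by push_cast; rw [ZMod.natCast_zmod_val])
    simp only [hψ]
    rw [e1, e2, e3, e4]
    exact h
  -- twice the sum, paired
  set S : ℝ := ∑ x : Tor N, ψ (x ν) * Φ x * A x with hS
  have hS' : ∑ x : Tor N, (∏ μ, Real.cosh (a * (circAbs (N μ) ((c μ - x μ : ZMod (N μ)).val) : ℝ))) * |k (x - unitVec N ν) - k x| = S :=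
    Finset.sum_congr rfl fun x _ => by rw [hfac x]
  have hSτ : S = ∑ x : Tor N, ψ (τ x ν) * Φ x * A x := by
    rw [hS, ← hsum (fun x => ψ (x ν) * Φ x * A x)]
    exact Finset.sum_congr rfl fun x _ => by rw [hΦτ, hAτ]
  -- the two halves of the right side coincide after `τ`
  set S₀ : ℝ := ∑ x : Tor N, Real.cosh (a * (circAbs (N ν) (((x ν).val : ℕ) : ℤ) : ℝ)) * Φ x * A x with hS₀
  have hS₁ : ∑ x : Tor N, Real.cosh (a * (circAbs (N ν) (((x ν - 1 : ZMod (N ν)).val : ℕ) : ℤ) : ℝ)) * Φ x * A x = S₀ := by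
    rw [hS₀, ← hsum (fun x => Real.cosh (a * (circAbs (N ν) (((x ν - 1 : ZMod (N ν)).val : ℕ) : ℤ) : ℝ)) * Φ x * A x)]
    refine Finset.sum_congr rfl fun x _ => ?_
    rw [hΦτ, hAτ, hτν, show (1 - x ν - 1 : ZMod (N ν)) = -x ν by ring, circAbs_neg_val]
  -- (W-0) on `S₀`
  have hW0 : S₀ ≤ Φ 0 * ((1 + Real.cosh a) * G 0 + 2 * Real.sinh a * ∑ j ∈ Finset.Ico 1 (N ν / 2), Real.sinh (a * j) * G (j : ZMod (N ν))) := by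
    have h := weighted_sum_abs_sub_le_cosh N t hm hCm hk ν hn hΦ0 hΦν hΦR (fun x => transverse_cosh_defect N t a ν c x) hG ha
    refine le_of_eq_of_le (Finset.sum_congr rfl fun x _ => ?_) h
    rw [circAbs_val_eq_min]
    push_cast
    rfl
  -- assemble
  have hF : 0 ≤ 2 / (1 + Real.exp (-a)) * ψ 0 := mul_nonneg (by positivity) (Real.cosh_pos _).le
  have h2S : 2 * S ≤ 2 / (1 + Real.exp (-a)) * ψ 0 * (2 * S₀) := by
    calc 2 * S = S + ∑ x : Tor N, ψ (τ x ν) * Φ x * A x := by rw [two_mul, ← hSτ]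
      _ = ∑ x : Tor N, (ψ (x ν) + ψ (τ x ν)) * (Φ x * A x) := by
          rw [hS, ← Finset.sum_add_distrib]
          exact Finset.sum_congr rfl fun x _ => by ring
      _ ≤ ∑ x : Tor N, (2 / (1 + Real.exp (-a)) * ψ 0 * (Real.cosh (a * (circAbs (N ν) (((x ν).val : ℕ) : ℤ) : ℝ)) +
            Real.cosh (a * (circAbs (N ν) (((x ν - 1 : ZMod (N ν)).val : ℕ) : ℤ) : ℝ)))) * (Φ x * A x) :=
          Finset.sum_le_sum fun x _ => mul_le_mul_of_nonneg_right (hpair x) (mul_nonneg (hΦ0 x) (hA0 x))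
      _ = 2 / (1 + Real.exp (-a)) * ψ 0 * (S₀ + ∑ x : Tor N, Real.cosh (a * (circAbs (N ν) (((x ν - 1 : ZMod (N ν)).val : ℕ) : ℤ) : ℝ)) * Φ x * A x) := by
          rw [hS₀, ← Finset.sum_add_distrib, Finset.mul_sum]
          exact Finset.sum_congr rfl fun x _ => by ring
      _ = 2 / (1 + Real.exp (-a)) * ψ 0 * (2 * S₀) := by rw [hS₁, two_mul]
  have hmain : S ≤ 2 / (1 + Real.exp (-a)) * ψ 0 * S₀ := by linarith
  rw [hS', hfac 0]
  calc S ≤ 2 / (1 + Real.exp (-a)) * ψ 0 * S₀ := hmain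
    _ ≤ 2 / (1 + Real.exp (-a)) * ψ 0 * (Φ 0 * ((1 + Real.cosh a) * G 0 +
          2 * Real.sinh a * ∑ j ∈ Finset.Ico 1 (N ν / 2), Real.sinh (a * j) * G (j : ZMod (N ν)))) := mul_le_mul_of_nonneg_left hW0 hF
    _ = _ := by simp only [Pi.zero_apply]; ring

/-- a solution of the cycle equation with source `δ₀` is even (uniqueness, `B5Eq129FreeResolventCycleProfile.cycle_eq_of_resolvent_eq`). [folklore] -/
private theorem cycle_solution_even {n : ℕ} [NeZero n] (t : ℝ) {μ : ℝ} (hμ : 0 < μ) {G : ZMod n → ℝ}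
    (hG : ∀ s, t ^ 2 * ((G s - G (s - 1)) + (G s - G (s + 1))) + μ * G s = if s = 0 then 1 else 0) (s : ZMod n) :
    G (-s) = G s := by
  have h := cycle_eq_of_resolvent_eq t hμ (φ₁ := fun s => G (-s)) (φ₂ := G) (ψ := fun s => if s = 0 then (1 : ℝ) else 0)
    (fun s => by
      have e := hG (-s)
      simp only [neg_eq_zero] at e
      rw [← e, show -s - 1 = -(s + 1) by ring, show -s + 1 = -(s - 1) by ring]
      ring) hG
  exact congrFun h s

/-- **THE PAIRED EVERY-CENTRE ROW, UNIFORMLY IN THE PERIODS**, in the OWNER's rate window `2d·t²(cosh a − 1) < m` (`λ = m − 2d·t²(cosh a − 1) > 0`):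
`Σ_x W_c(x)·|k(x − e_ν) − k(x)| ≤ (2∕(1+e^{−a}))·W_c(0)·[(1 + e^{−a})·G(0) + sinh a∕λ]` — `sum_weight_mul_abs_sub_le_paired` folded by
`B5Eq129CycleWeightedMass.cosh_bracket_le_uniform` (`G ≥ 0` by `cycle_solution_nonneg`, `G` even).  Multiplied out: `W_c(0)·[2G(0) + 2 sinh a∕((1+e^{−a})λ)]`, against
`B5Eq129FreeResolventWeightedGradientRowCosh.sum_weight_mul_abs_sub_le_uniform`'s `W_c(0)·[(1 + e^{−a})G(0) + 2 sinh a∕λ]`. [folklore]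
[cite: Balaban1984PropagatorsI, (1.29) p.23, p.36; Balaban1985BackgroundPropagators, Thm 3.1 (3.42) p.397] -/
theorem sum_weight_mul_abs_sub_le_paired_uniform (t : ℝ) {m a : ℝ} (hm : 0 < m) (ha : 0 ≤ a)
    (hlam : 2 * (d : ℝ) * t ^ 2 * (Real.cosh a - 1) < m) {k : Tor N → ℝ}
    (hk : ∀ x, ∑ ν, t ^ 2 * ((k x - k (x - unitVec N ν)) + (k x - k (x + unitVec N ν))) + m * k x = if x = 0 then 1 else 0)
    (ν : Fin d) (hn : 2 ≤ N ν) (c : Tor N) {G : ZMod (N ν) → ℝ}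
    (hG : ∀ s, t ^ 2 * ((G s - G (s - 1)) + (G s - G (s + 1))) + (m - 2 * ((d : ℝ) - 1) * t ^ 2 * (Real.cosh a - 1)) * G s =
      if s = 0 then 1 else 0) :
    ∑ x : Tor N, (∏ μ, Real.cosh (a * (circAbs (N μ) ((c μ - x μ : ZMod (N μ)).val) : ℝ))) * |k (x - unitVec N ν) - k x| ≤
      2 / (1 + Real.exp (-a)) * (∏ μ, Real.cosh (a * (circAbs (N μ) ((c μ - (0 : Tor N) μ : ZMod (N μ)).val) : ℝ))) *
        ((1 + Real.exp (-a)) * G 0 + Real.sinh a / (m - 2 * (d : ℝ) * t ^ 2 * (Real.cosh a - 1))) := by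
  have hct : 0 ≤ t ^ 2 * (Real.cosh a - 1) := mul_nonneg (sq_nonneg t) (by linarith [Real.one_le_cosh a])
  have hCm : 2 * ((d : ℝ) - 1) * t ^ 2 * (Real.cosh a - 1) < m := by nlinarith
  have hμ : 0 < m - 2 * ((d : ℝ) - 1) * t ^ 2 * (Real.cosh a - 1) := by linarith
  have hlam' : 2 * t ^ 2 * (Real.cosh a - 1) < m - 2 * ((d : ℝ) - 1) * t ^ 2 * (Real.cosh a - 1) := by nlinarith
  have hG0 : ∀ s, 0 ≤ G s := cycle_solution_nonneg t hμ hG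
  have hGeven : ∀ s, G (-s) = G s := cycle_solution_even t hμ hG
  have hB := cosh_bracket_le_uniform t ha hlam' hG hG0 hGeven
  have e : m - 2 * ((d : ℝ) - 1) * t ^ 2 * (Real.cosh a - 1) - 2 * t ^ 2 * (Real.cosh a - 1) = m - 2 * (d : ℝ) * t ^ 2 * (Real.cosh a - 1) := by
    ring
  rw [e] at hB
  refine (sum_weight_mul_abs_sub_le_paired N t hm ha hCm hk ν hn c hG).trans (mul_le_mul_of_nonneg_left hB ?_)
  exact mul_nonneg (by positivity) (Finset.prod_nonneg fun _ _ => (Real.cosh_pos _).le)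

end Literature.MathematicalPhysics.QuantumFieldTheory.Balaban1983to89.B5Eq129FreeResolventWeightedGradientRowPaired

end
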